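import Summits.FinalStateConjecture.FinalStateConjecture.Theorems.PhaseMixingCaptureBulkKerrCaptureC2CentreGauge
import Literature.Geometry.Lorentzian.WeightedNormsProofs
import Mathlib.MeasureTheory.Function.LocallyIntegrable
import Mathlib.MeasureTheory.Integral.IntegrableOn
import HarnessLib

/-!
# Crux `PhaseMixingCapture.BulkKerrCaptureC2` (stmt-FinalStateConjecture-14985): the gauge orbit of the
# centre consists of ADMISSIBLE competitors

Support file, sequel of `PhaseMixingCaptureBulkKerrCaptureC2CentreGauge.lean`.  There the CONCLUSION of
the crux (far-complete `𝓘⁺`, `C²`-convergence to `g_{M,a}`, for every maximal vacuum Cauchy development) was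
proved for every datum `Φ^* Kerr.data M a M` on the gauge orbit of the centre of the data ball (`Φ` a
diffeomorphism of the slice fixing the complement of a compact set).  Here the two non-metric HYPOTHESES
of the crux are verified for the same data:

* `dataWeightedSobolevEDist_comap_lt_top` — for every order `s` and every weight `δ`, the `H^s_δ × H^{s-1}_{δ+1}`
  distance of `Φ^* D` to `D` is finite (any data `D` on any open `U ⊆ ℝ³`, any such `Φ`): the component
  differences are smooth on `U` (`InitialDataSet.contDiffAt_hFun/kFun`) and vanish off the compact set
  (`comap_h_inner_eq_of_notMem`: `dΦ_u = id` where `Φ = id` near `u`), hence are compactly supported smooth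
  functions on `ℝ³`, whose weighted Sobolev seminorms are all finite
  (`weightedSobolevSeminorm_lt_top_of_hasCompactSupport`, the general lemma of §1);
* so, with `isVacuumConstraintSolution_gauge` (constraints) and `captureC2At_gauge` (conclusion) of the
  prequel, EVERY clause of the crux's matrix except the `ε`-smallness of the distance is a theorem on the
  gauge orbit, at every order and every weight: `cruxMatrix_gauge`, `stub_gauge_admissible`.

What this does NOT show: that gauge data other than the centre lie in a GIVEN `ε`-ball (continuity of
`Φ ↦ Φ^* Kerr.data` at `Φ = id` in `H^s_δ`), nor anything about non-stationary data (the nonlinear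
stability theorem itself, `Literature.Geometry.Lorentzian.hintz_kerr_stability_subextremal_cauchy_allOrders`).

References: R. Bartnik, CPAM 39 (1986), §1 (weighted Sobolev classes); R. Bartnik, J. Isenberg, *The
constraint equations* (2004), §2 (diffeomorphism equivariance of data).
-/

-- the doubled `FinalStateConjecture.FinalStateConjecture` path component trips dupNamespace
set_option linter.dupNamespace false

noncomputable section

open Set Filter Function Topology MeasureTheory TopologicalSpace
open scoped Manifold ContDiff Topology
open Literature.Geometry.Lorentzian

namespace Summit.FinalStateConjecture.FinalStateConjecture.Theorems.BulkKerrCaptureC2.Centre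

/-! ## §1 Compactly supported smooth functions have finite weighted Sobolev seminorms -/

section Seminorm

variable {F G : Type*} [NormedAddCommGroup F] [NormedSpace ℝ F] [MeasureSpace F]
  [OpensMeasurableSpace F] [IsFiniteMeasureOnCompacts (volume : Measure F)]
  [NormedAddCommGroup G] [NormedSpace ℝ G]

/-- Each weighted `L²` term of the `H^s_δ(U)` seminorm of a compactly supported smooth function is
finite: the integrand `(1+‖x‖)^p ‖D^m f(x)‖²` is continuous with compact support, hence integrable on
the whole space. Bartnik 1986, §1 (`C^∞_c ⊆ W^{k,p}_δ`). [folklore] -/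
theorem lintegral_weight_mul_iteratedFDeriv_sq_lt_top {f : F → G} (hf : ContDiff ℝ ∞ f)
    (hsupp : HasCompactSupport f) (U : Set F) (p : ℝ) (m : ℕ) :
    ∫⁻ x in U, ENNReal.ofReal ((1 + ‖x‖) ^ p * ‖iteratedFDeriv ℝ m f x‖ ^ 2) < ⊤ := by
  refine lt_of_le_of_lt (setLIntegral_le_lintegral U _) (Integrable.lintegral_lt_top ?_)
  have hw : Continuous fun x : F ↦ (1 + ‖x‖) ^ p :=
    (continuous_const.add continuous_norm).rpow_const fun x ↦
      Or.inl (add_pos_of_pos_of_nonneg one_pos (norm_nonneg x)).ne'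
  have hg : Continuous fun x : F ↦ ‖iteratedFDeriv ℝ m f x‖ ^ 2 :=
    (hf.continuous_iteratedFDeriv (by exact_mod_cast le_top)).norm.pow 2
  have hgs : HasCompactSupport fun x : F ↦ ‖iteratedFDeriv ℝ m f x‖ ^ 2 :=
    ((hsupp.iteratedFDeriv m).norm).comp_left (g := fun t : ℝ ↦ t ^ 2) (by simp)
  exact (hw.mul hg).integrable_of_hasCompactSupport hgs.mul_left

/-- **Compactly supported smooth functions have finite weighted Sobolev seminorms**
`‖f‖_{H^s_δ(U)} < ∞`, for every set `U`, order `s` and weight `δ`. Bartnik 1986, §1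
(`C^∞_c ⊆ W^{k,p}_δ`, the spaces being completions of `C^∞_c`). [folklore] -/
theorem weightedSobolevSeminorm_lt_top_of_hasCompactSupport {f : F → G} (hf : ContDiff ℝ ∞ f)
    (hsupp : HasCompactSupport f) (U : Set F) (s : ℕ) (δ : ℝ) :
    weightedSobolevSeminorm U s δ f < ⊤ := by
  unfold weightedSobolevSeminorm
  refine ENNReal.rpow_lt_top_of_nonneg (by norm_num) (ne_of_lt ?_)
  exact ENNReal.sum_lt_top.2 fun m _ ↦
    lintegral_weight_mul_iteratedFDeriv_sq_lt_top hf hsupp U _ m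

end Seminorm

/-! ## §2 Data agreeing off a compact set are at finite distance at every order and weight -/

section Data

variable {G : Type*} [NormedAddCommGroup G] [NormedSpace ℝ G] {U : Opens E3}

/-- A function on `ℝ³` that is smooth at every point of the open set `U` and vanishes off a compact
subset `K ⊆ U` is a compactly supported smooth function (off `K` it is locally zero). [folklore] -/
theorem contDiff_and_hasCompactSupport_of_eq_zero_off {f : E3 → G} {K : Set E3} (hK : IsCompact K)
    (hKU : K ⊆ U) (hf : ∀ y ∈ (U : Set E3), ContDiffAt ℝ ∞ f y) (hzero : ∀ y, y ∉ K → f y = 0) :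
    ContDiff ℝ ∞ f ∧ HasCompactSupport f := by
  refine ⟨contDiff_iff_contDiffAt.2 fun y ↦ ?_, ?_⟩
  · by_cases hy : y ∈ K
    · exact hf y (hKU hy)
    · have hev : f =ᶠ[𝓝 y] fun _ ↦ 0 :=
        (hK.isClosed.isOpen_compl.eventually_mem hy).mono fun z hz ↦ hzero z hz
      exact (contDiffAt_const (c := (0 : G))).congr_of_eventuallyEq hev
  · exact HasCompactSupport.of_support_subset_isCompact hK fun y hy ↦
      by_contra fun hyK ↦ hy (hzero y hyK)

/-- **Initial data sets on an open `U ⊆ ℝ³` that agree off a compact set are at finite weighted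
Sobolev distance `H^s_δ × H^{s-1}_{δ+1}` for every `s` and every `δ`**: the component differences
`h₁ - h₂`, `k₁ - k₂` (junk-extended, so zero off `U`) are smooth on `U` and vanish off the compact
set, so §1 applies. Bartnik 1986, §1. [folklore] -/
theorem dataWeightedSobolevEDist_lt_top_of_eq_off_compact (D₁ D₂ : InitialDataSet 𝓘(ℝ, E3) U)
    {K₀ : Set U} (hK₀ : IsCompact K₀) (hh : ∀ u : U, u ∉ K₀ → D₁.h.inner u = D₂.h.inner u)
    (hk : ∀ u : U, u ∉ K₀ → D₁.k u = D₂.k u) (s : ℕ) (δ : ℝ) :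
    InitialDataSet.dataWeightedSobolevEDist s δ D₁ D₂ < ⊤ := by
  have hK : IsCompact (((↑) : U → E3) '' K₀) := hK₀.image continuous_subtype_val
  have hKU : ((↑) : U → E3) '' K₀ ⊆ (U : Set E3) := by
    rintro _ ⟨u, _, rfl⟩
    exact u.2
  have hzero_h : ∀ y : E3, y ∉ ((↑) : U → E3) '' K₀ → (D₁.hFun - D₂.hFun) y = 0 := by
    intro y hy
    have hyy : D₁.hFun y = D₂.hFun y := by
      by_cases hyU : y ∈ (U : Set E3)
      · have hu : (⟨y, hyU⟩ : U) ∉ K₀ := fun h ↦ hy ⟨_, h, rfl⟩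
        rw [D₁.hFun_of_mem hyU, D₂.hFun_of_mem hyU, hh _ hu]
      · rw [D₁.hFun_of_not_mem hyU, D₂.hFun_of_not_mem hyU]
    rw [Pi.sub_apply, hyy]
    exact sub_self (D₂.hFun y)
  have hzero_k : ∀ y : E3, y ∉ ((↑) : U → E3) '' K₀ → (D₁.kFun - D₂.kFun) y = 0 := by
    intro y hy
    have hyy : D₁.kFun y = D₂.kFun y := by
      by_cases hyU : y ∈ (U : Set E3)
      · have hu : (⟨y, hyU⟩ : U) ∉ K₀ := fun h ↦ hy ⟨_, h, rfl⟩
        rw [D₁.kFun_of_mem hyU, D₂.kFun_of_mem hyU, hk _ hu]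
      · rw [D₁.kFun_of_not_mem hyU, D₂.kFun_of_not_mem hyU]
    rw [Pi.sub_apply, hyy]
    exact sub_self (D₂.kFun y)
  obtain ⟨hcd_h, hcs_h⟩ := contDiff_and_hasCompactSupport_of_eq_zero_off hK hKU
    (fun y hy ↦ (D₁.contDiffAt_hFun ⟨y, hy⟩).sub (D₂.contDiffAt_hFun ⟨y, hy⟩)) hzero_h
  obtain ⟨hcd_k, hcs_k⟩ := contDiff_and_hasCompactSupport_of_eq_zero_off hK hKU
    (fun y hy ↦ (D₁.contDiffAt_kFun ⟨y, hy⟩).sub (D₂.contDiffAt_kFun ⟨y, hy⟩)) hzero_k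
  unfold InitialDataSet.dataWeightedSobolevEDist
  exact ENNReal.add_lt_top.2
    ⟨weightedSobolevSeminorm_lt_top_of_hasCompactSupport hcd_h hcs_h _ _ _,
      weightedSobolevSeminorm_lt_top_of_hasCompactSupport hcd_k hcs_k _ _ _⟩

/-! ### Pull-back along a diffeomorphism fixing the complement of a compact set -/

variable (D : InitialDataSet 𝓘(ℝ, E3) U) (Φ : U → U) (hΦ : ContMDiff (𝓡 3) (𝓡 3) (∞ + 1) Φ)
  (hΦ' : ∀ u, Function.Injective (mfderiv (𝓡 3) (𝓡 3) Φ u)) {K₀ : Set U}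

/-- Where `Φ` is the identity near `u` (off the compact, hence closed, set `K₀`), its differential is
the identity: `dΦ_u = id`. O'Neill 1983, Ch. 1 (the differential is local). [folklore] -/
theorem mfderiv_eq_id_of_notMem (hK₀ : IsCompact K₀) (hfix : ∀ y, y ∉ K₀ → Φ y = y) {u : U}
    (hu : u ∉ K₀) : mfderiv (𝓡 3) (𝓡 3) Φ u = ContinuousLinearMap.id ℝ _ := by
  have hev : Φ =ᶠ[𝓝 u] id :=
    (hK₀.isClosed.isOpen_compl.eventually_mem hu).mono fun y hy ↦ hfix y hy
  rw [hev.mfderiv_eq, mfderiv_id]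

/-- Transport of a field of bilinear forms on the tangent spaces of `U` (all equal to `E3`) along an
equality of base points. [folklore] -/
theorem bilin_congr_point (B : (x : U) → TangentSpace 𝓘(ℝ, E3) x →L[ℝ] TangentSpace 𝓘(ℝ, E3) x →L[ℝ] ℝ)
    {x y : U} (hxy : x = y) (v w : E3) : B x v w = B y v w := by
  subst hxy
  rfl

/-- Off the compact set where `Φ = id`, the pulled-back metric is the metric:
`(Φ^* h)_u = h_u` (`Φ u = u`, `dΦ_u = id`). Bartnik–Isenberg 2004, §2. [folklore] -/
theorem comap_h_inner_eq_of_notMem (hK₀ : IsCompact K₀) (hfix : ∀ y, y ∉ K₀ → Φ y = y) {u : U}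
    (hu : u ∉ K₀) : (D.comap Φ hΦ hΦ').h.inner u = D.h.inner u := by
  have hd := mfderiv_eq_id_of_notMem Φ hK₀ hfix hu
  ext v w
  rw [InitialDataSet.comap_h_inner, hd]
  exact bilin_congr_point D.h.inner (hfix u hu) v w

/-- Off the compact set where `Φ = id`, the pulled-back second fundamental form is the original one:
`(Φ^* k)_u = k_u`. Bartnik–Isenberg 2004, §2. [folklore] -/
theorem comap_k_eq_of_notMem (hK₀ : IsCompact K₀) (hfix : ∀ y, y ∉ K₀ → Φ y = y) {u : U}
    (hu : u ∉ K₀) : (D.comap Φ hΦ hΦ').k u = D.k u := by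
  have hd := mfderiv_eq_id_of_notMem Φ hK₀ hfix hu
  ext v w
  rw [InitialDataSet.comap_k, hd]
  exact bilin_congr_point D.k (hfix u hu) v w

/-- **The gauge orbit is at finite distance at every order and weight**: for a smooth local
diffeomorphism `Φ` of the open `U ⊆ ℝ³` with `Φ = id` off a compact set, and any data `D` on `U`,
`dist_{H^s_δ × H^{s-1}_{δ+1}}(Φ^* D, D) < ∞` for all `s`, `δ`. Bartnik 1986, §1; Bartnik–Isenberg
2004, §2. [folklore] -/
theorem dataWeightedSobolevEDist_comap_lt_top (hK₀ : IsCompact K₀) (hfix : ∀ y, y ∉ K₀ → Φ y = y)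
    (s : ℕ) (δ : ℝ) :
    InitialDataSet.dataWeightedSobolevEDist s δ (D.comap Φ hΦ hΦ') D < ⊤ :=
  dataWeightedSobolevEDist_lt_top_of_eq_off_compact _ _ hK₀
    (fun _ hu ↦ comap_h_inner_eq_of_notMem D Φ hΦ hΦ' hK₀ hfix hu)
    (fun _ hu ↦ comap_k_eq_of_notMem D Φ hΦ hΦ' hK₀ hfix hu) s δ

end Data

/-! ## §3 The crux's matrix on the gauge orbit of the centre: everything but `ε`-smallness -/

section Gauge

variable {M a : ℝ} [Kerr.Facts] [Kerr.SliceFacts]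

/-- **All-orders admissibility of the gauge orbit of the centre**: for `Φ` a diffeomorphism of the
Kerr–Schild slice fixing the complement of a compact set, the datum `Φ^* Kerr.data M a M` is at finite
`H^{s'}_δ × H^{s'-1}_{δ+1}` distance from `Kerr.data M a M` for EVERY order `s'` and EVERY weight `δ` — the
second hypothesis of the crux `BulkKerrCaptureC2` on its competitors. [folklore] -/
theorem admissible_gauge (hM : 0 ≤ M) (Φ : Kerr.slice a M → Kerr.slice a M)
    (hΦ : ContMDiff (𝓡 3) (𝓡 3) (∞ + 1) Φ) (hΦ' : ∀ u, Function.Injective (mfderiv (𝓡 3) (𝓡 3) Φ u))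
    {K₀ : Set (Kerr.slice a M)} (hK₀ : IsCompact K₀) (hfix : ∀ y, y ∉ K₀ → Φ y = y) (δ : ℝ) :
    ∀ s' : ℕ, InitialDataSet.dataWeightedSobolevEDist s' δ ((Kerr.data M a M hM).comap Φ hΦ hΦ')
      (Kerr.data M a M hM) < ⊤ :=
  fun s' ↦ dataWeightedSobolevEDist_comap_lt_top _ Φ hΦ hΦ' hK₀ hfix s' δ

/-- **The crux's matrix on the gauge orbit, every clause but `ε`-smallness.**  For sub-extremal
`|a| < M`, any tolerance `η ≥ 0`, any diffeomorphism `Φ` of the slice fixing the complement of a compact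
set, and ANY order `s` and weight `δ`, the competitor `D := Φ^* Kerr.data M a M` of the crux
`BulkKerrCaptureC2` satisfies: (i) the vacuum constraints (`isVacuumConstraintSolution_gauge`); (ii) the
all-orders finiteness hypothesis `∀ s', dist_{s',δ}(D, Kerr.data M a M) < ∞` (`admissible_gauge`); and
(iii) the conclusion — every maximal vacuum Cauchy development of `D` has far-complete `𝓘⁺` and converges in
`C²` to a sub-extremal `g_{M',a'}` with `|M' - M| + |a' - a| ≤ η` (`captureC2At_gauge`, with
`(M', a') = (M, a)`).  Only the clause `dist_{s,δ}(D, Kerr.data M a M) < ε` of the crux is not asserted.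
[folklore] -/
theorem cruxMatrix_gauge (hM : 0 < M) (ha : |a| < M) {η : ℝ} (hη : 0 ≤ η)
    (Φ : Kerr.slice a M ≃ₜ Kerr.slice a M) (hΦ : ContMDiff (𝓡 3) (𝓡 3) (∞ + 1) Φ)
    (hΦ' : ∀ u, Function.Injective (mfderiv (𝓡 3) (𝓡 3) Φ u))
    {K₀ : Set (Kerr.slice a M)} (hK₀ : IsCompact K₀) (hfix : ∀ y, y ∉ K₀ → Φ y = y) (δ : ℝ) :
    (∀ [((Kerr.data M a M hM.le).comap Φ hΦ hΦ').metric.HasLeviCivita],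
        ((Kerr.data M a M hM.le).comap Φ hΦ hΦ').IsVacuumConstraintSolution) ∧
      (∀ s' : ℕ, InitialDataSet.dataWeightedSobolevEDist s' δ
        ((Kerr.data M a M hM.le).comap Φ hΦ hΦ') (Kerr.data M a M hM.le) < ⊤) ∧
      ∀ 𝒟 : VacuumCauchyDevelopment ((Kerr.data M a M hM.le).comap Φ hΦ hΦ'), 𝒟.IsMaximal →
        ∃ (M' a' : ℝ) (𝒟oc : Set 𝒟.carrier), Kerr.IsSubextremal M' a' ∧
          𝒟.HasCompleteFutureNullInfinityFar ∧ 𝒟.toSpacetime.ConvergesToKerr 𝒟oc M' a' 2 ∧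
          |M' - M| + |a' - a| ≤ η :=
  ⟨fun {_} ↦ isVacuumConstraintSolution_gauge hM.le Φ hΦ hΦ',
    admissible_gauge hM.le Φ hΦ hΦ' hK₀ hfix δ,
    fun 𝒟 hmax ↦ captureC2At_gauge hM ha hη Φ hΦ hΦ' hK₀ hfix 𝒟 hmax⟩

end Gauge

/-- Registered stub `stub_gauge_admissible` of the crux item (verbatim signature): the statement of
`cruxMatrix_gauge` with all binders explicit. [folklore] -/
theorem stub_gauge_admissible : ∀ [Kerr.Facts] [Kerr.SliceFacts] (M : ℝ) (hM : 0 < M) (a : ℝ), |a| < M → ∀ η : ℝ, 0 ≤ η → ∀ (Φ : Kerr.slice a M ≃ₜ Kerr.slice a M) (hΦ : ContMDiff (𝓡 3) (𝓡 3) (∞ + 1) Φ) (hΦ' : ∀ u, Function.Injective (mfderiv (𝓡 3) (𝓡 3) Φ u)) (K₀ : Set (Kerr.slice a M)), IsCompact K₀ → (∀ y, y ∉ K₀ → Φ y = y) → ∀ δ : ℝ, (∀ [((Kerr.data M a M hM.le).comap Φ hΦ hΦ').metric.HasLeviCivita], ((Kerr.data M a M hM.le).comap Φ hΦ hΦ').IsVacuumConstraintSolution)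 ∧ (∀ s' : ℕ, InitialDataSet.dataWeightedSobolevEDist s' δ ((Kerr.data M a M hM.le).comap Φ hΦ hΦ') (Kerr.data M a M hM.le) < ⊤) ∧ ∀ 𝒟 : VacuumCauchyDevelopment ((Kerr.data M a M hM.le).comap Φ hΦ hΦ'), 𝒟.IsMaximal → ∃ (M' a' : ℝ) (𝒟oc : Set 𝒟.carrier), Kerr.IsSubextremal M' a' ∧ 𝒟.HasCompleteFutureNullInfinityFar ∧ 𝒟.toSpacetime.ConvergesToKerr 𝒟oc M' a' 2 ∧ |M' - M| + |a' - a| ≤ η :=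
  fun _ hM _ ha _ hη Φ hΦ hΦ' _ hK₀ hfix δ ↦ cruxMatrix_gauge hM ha hη Φ hΦ hΦ' hK₀ hfix δ


end Summit.FinalStateConjecture.FinalStateConjecture.Theorems.BulkKerrCaptureC2.Centre
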